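import Summits.AtomisticToContinuum.Crystallization.Theses.FluxTubeKepler

/-!
# Negative knowledge for crux `FluxTubeKepler.FluxCellKepler` (stmt-AtomisticToContinuum-15221), I:
# what the crux forces, and the vacuity of its KEPLER half

Refuter crux-attack by-products (`--supports stmt-AtomisticToContinuum-15221`). The crux is
`X = ∃ P₀ R₁ τ, DOM ∧ KEPLER` (a local tail credit `τ` dominating the `r⁻⁶` site energies, whose
cell functional `λ_i = (1/24) site₁₂,i − τ_i/12` obeys a Kepler-type inequality with the sharp
constant `e(P₀)` and a linear penalty per non-layered site). All `[folklore]`, written out with no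
definitions:

* **`kepler_half_trivial`** — the KEPLER conjunct ALONE holds for every `P₀, R₁` with the constant
  credit `τ ≡ −(12·|e(P₀)| + 12)` and `c = 1`: any proof or disproof of `X` must use DOM (the two
  conjuncts bite only jointly; KEPLER is antitone in `τ`, DOM monotone).
* **`fluxCellKepler_consequences`** — `X` forces, for its witness `P₀`:
  (a) the floor `N · e(P₀) ≤ E_LJ(x)` for EVERY finite injective configuration (DOM + KEPLER with
  `c · #bad ≥ 0`; every finite injective configuration is `δ`-separated for its own `δ`);
  (b) `e(P₀) = ⨅_Q e(Q)` (with the tree's `crysEnergyLimit` and `eStar_le`), so `P₀` is a periodic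
  MINIMISER — `X` implies item 0627 `CrysPeriodicMinAttained`
  (`fluxCellKepler_periodicMinAttained`) and conjunct (i) of the summit
  (`fluxCellKepler_hasPeriodicGroundStateEnergy`);
  (c) the `τ`-free linear defect pricing `c(δ,R,η) · #bad_{R,η}(x) ≤ E_LJ(x) − N · ⨅_Q e(Q)` on
  `δ`-separated configurations (the birth skeleton's `stub_defectPricedExcess`).
-/

noncomputable section

open scoped BigOperators
open Literature.MathematicalPhysics.StatisticalMechanics
open Summit.AtomisticToContinuum.Crystallization.Theses.FluxTubeKepler
open Summit.AtomisticToContinuum.Crystallization.Theorems.ChargedEnergyGapNegative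

namespace Summit.AtomisticToContinuum.Crystallization.Theorems.FluxCellKepler.Negative.Consequences

/-- A subtype of `Fin N` has at most `N` elements (real-cast form). [folklore] -/
theorem natCard_subtype_fin_le {N : ℕ} (p : Fin N → Prop) :
    (Nat.card {i : Fin N // p i} : ℝ) ≤ N := by
  have h : Nat.card {i : Fin N // p i} ≤ Nat.card (Fin N) := Finite.card_subtype_le p
  simp only [Nat.card_eq_fintype_card, Fintype.card_fin] at h
  exact_mod_cast h

/-- **The KEPLER half of `FluxCellKepler` alone is vacuous**: for every `P₀, R₁` the constant credit
`τ ≡ −(12|e(P₀)| + 12)` satisfies it with `c = 1` (each cell value is then `≥ |e(P₀)| + 1`, so the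
cell sum exceeds `N e(P₀)` by at least `N ≥ #bad`). [folklore] -/
theorem kepler_half_trivial (P₀ : PeriodicConfiguration 3) (R₁ : ℝ) :
    ∃ τ : Finset (EuclideanSpace ℝ (Fin 3)) → ℝ,
      ∀ δ : ℝ, 0 < δ → ∀ R η : ℝ, 0 < R → 0 < η → ∃ c : ℝ, 0 < c ∧ ∀ (N : ℕ) (x : Fin N → EuclideanSpace ℝ (Fin 3)), Function.Injective x → (∀ i j, i ≠ j → δ ≤ dist (x i) (x j)) → c * (Nat.card {i : Fin N // ¬ ∃ a : ℝ, 47 / 50 ≤ a ∧ a ≤ 1 ∧ ∃ (A : EuclideanSpace ℝ (Fin 3) →ₗᵢ[ℝ] EuclideanSpace ℝ (Fin 3)) (s : ℤ → ℤ) (z : ℤ → ℝ), IsHaggSeq s ∧ (∀ m : ℤ, 39 / 50 * a ≤ z (m + 1) - z m ∧ z (m + 1) - z m ≤ 17 / 20 * a) ∧ let S : Set (EuclideanSpace ℝ (Fin 3)) := {p | ∃ m k l : ℤ, p = A (((k : ℝ) • triangularVec₁ a) + ((l : ℝ) • triangularVec₂ a) + ((haggLabel s m : ℝ) • barlowOffset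 a) + (z m • layerNormal 1))}; (∀ p ∈ S, ‖p‖ ≤ R → ∃ j : Fin N, dist (x j - x i) p ≤ η) ∧ (∀ j : Fin N, ‖x j - x i‖ ≤ R → ∃ p ∈ S, dist (x j - x i) p ≤ η)} : ℝ) ≤ ∑ i, ((1 / 24 : ℝ) * siteEnergy (fun r => (r⁻¹) ^ 12) x i - (1 / 12 : ℝ) * τ ((Finset.univ.filter fun j : Fin N => dist (x j) (x i) ≤ R₁).image fun j => x j - x i)) - (N : ℝ) * P₀.energyPerParticle lennardJones := by
  refine ⟨fun _ => -(12 * |P₀.energyPerParticle lennardJones| + 12), ?_⟩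
  intro δ _ R η _ _
  refine ⟨1, one_pos, ?_⟩
  intro N x _ _
  rw [one_mul]
  refine le_trans (natCard_subtype_fin_le _) ?_
  have hsite : ∀ i : Fin N, 0 ≤ siteEnergy (fun r => (r⁻¹) ^ 12) x i :=
    fun i => Finset.sum_nonneg fun k _ => by positivity
  have hterm : ∀ i ∈ (Finset.univ : Finset (Fin N)), |P₀.energyPerParticle lennardJones| + 1 ≤
      (1 / 24 : ℝ) * siteEnergy (fun r => (r⁻¹) ^ 12) x i
        - (1 / 12 : ℝ) * (-(12 * |P₀.energyPerParticle lennardJones| + 12)) := by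
    intro i _
    have := hsite i
    linarith
  have hs := Finset.sum_le_sum hterm
  simp only [Finset.sum_const, Finset.card_univ, Fintype.card_fin, nsmul_eq_mul] at hs
  have hNe : (N : ℝ) * P₀.energyPerParticle lennardJones
      ≤ (N : ℝ) * |P₀.energyPerParticle lennardJones| :=
    mul_le_mul_of_nonneg_left (le_abs_self _) (Nat.cast_nonneg N)
  linarith

/-- A finite injective configuration is `δ`-separated for some `δ > 0`. [folklore] -/
theorem exists_pos_sep {N : ℕ} {x : Fin N → EuclideanSpace ℝ (Fin 3)} (hx : Function.Injective x) :
    ∃ δ : ℝ, 0 < δ ∧ ∀ i j : Fin N, i ≠ j → δ ≤ dist (x i) (x j) := by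
  classical
  by_cases hN : ∃ p : Fin N × Fin N, p.1 ≠ p.2
  · set S : Finset ℝ := (Finset.univ.filter fun p : Fin N × Fin N => p.1 ≠ p.2).image
      fun p => dist (x p.1) (x p.2) with hS
    have hne : S.Nonempty := by
      obtain ⟨p, hp⟩ := hN
      exact ⟨_, Finset.mem_image.2 ⟨p, Finset.mem_filter.2 ⟨Finset.mem_univ _, hp⟩, rfl⟩⟩
    refine ⟨S.min' hne, ?_, fun i j hij => ?_⟩
    · obtain ⟨p, hp, hpeq⟩ := Finset.mem_image.1 (Finset.min'_mem S hne)
      rw [← hpeq]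
      exact dist_pos.2 fun h => (Finset.mem_filter.1 hp).2 (hx h)
    · exact Finset.min'_le S _
        (Finset.mem_image.2 ⟨(i, j), Finset.mem_filter.2 ⟨Finset.mem_univ _, hij⟩, rfl⟩)
  · exact ⟨1, one_pos, fun i j hij => absurd ⟨(i, j), hij⟩ hN⟩

/-- `E_LJ(x) = Σ_i ((1/24) site₁₂(x)_i − (1/12) site₆(x)_i)` (double counting and
`V_LJ = r⁻¹²/12 − r⁻⁶/6`; the constants of the crux). [folklore] -/
theorem interactionEnergy_lennardJones_eq_sum {N : ℕ} (x : Fin N → EuclideanSpace ℝ (Fin 3)) :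
    interactionEnergy lennardJones x
      = ∑ i, ((1 / 24 : ℝ) * siteEnergy (fun r => (r⁻¹) ^ 12) x i
          - (1 / 12 : ℝ) * siteEnergy (fun r => (r⁻¹) ^ 6) x i) := by
  have h2 := two_mul_interactionEnergy lennardJones x
  have hsite : ∀ i : Fin N, siteEnergy lennardJones x i
      = (1 / 12 : ℝ) * siteEnergy (fun r => (r⁻¹) ^ 12) x i
          - (1 / 6 : ℝ) * siteEnergy (fun r => (r⁻¹) ^ 6) x i := by
    intro i
    simp only [siteEnergy, lennardJones, Finset.sum_sub_distrib, Finset.mul_sum]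
  rw [Finset.sum_congr rfl fun i _ => hsite i] at h2
  have hE : interactionEnergy lennardJones x
      = (1 / 2 : ℝ) * ∑ i, ((1 / 12 : ℝ) * siteEnergy (fun r => (r⁻¹) ^ 12) x i
          - (1 / 6 : ℝ) * siteEnergy (fun r => (r⁻¹) ^ 6) x i) := by
    linarith
  rw [hE, Finset.mul_sum]
  exact Finset.sum_congr rfl fun i _ => by ring

/-- Bookkeeping: `c·k ≤ A − B`, `A ≤ E`, `c > 0`, `k ≥ 0` give `B ≤ E`. [folklore] -/
theorem floor_aux {c k A B E : ℝ} (h1 : c * k ≤ A - B) (h3 : A ≤ E) (hc : 0 < c) (hk : 0 ≤ k) :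
    B ≤ E := by
  have := mul_nonneg hc.le hk
  linarith

/-- **What `FluxCellKepler` forces on its witness `P₀`.** (a) The floor `N·e(P₀) ≤ E_LJ(x)` for
every finite injective `x`; (b) `e(P₀) = ⨅_Q e(Q)`, and `P₀` is a least-energy periodic
configuration; (c) the `τ`-free linear defect pricing `c(δ,R,η)·#bad ≤ E_LJ(x) − N·⨅_Q e(Q)` on
`δ`-separated configurations. [folklore] -/
theorem fluxCellKepler_consequences (h : FluxCellKepler) :
    ∃ P₀ : PeriodicConfiguration 3,
      (∀ (N : ℕ) (x : Fin N → EuclideanSpace ℝ (Fin 3)), Function.Injective x →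
        (N : ℝ) * P₀.energyPerParticle lennardJones ≤ interactionEnergy lennardJones x) ∧
      P₀.energyPerParticle lennardJones
        = ⨅ Q : PeriodicConfiguration 3, Q.energyPerParticle lennardJones ∧
      IsLeast (Set.range fun Q : PeriodicConfiguration 3 => Q.energyPerParticle lennardJones)
        (P₀.energyPerParticle lennardJones) ∧
      (∀ δ : ℝ, 0 < δ → ∀ R η : ℝ, 0 < R → 0 < η → ∃ c : ℝ, 0 < c ∧ ∀ (N : ℕ) (x : Fin N → EuclideanSpace ℝ (Fin 3)), Function.Injective x → (∀ i j, i ≠ j → δ ≤ dist (x i) (x j)) → c * (Nat.card {i : Fin N // ¬ ∃ a : ℝ, 47 / 50 ≤ a ∧ a ≤ 1 ∧ ∃ (A : EuclideanSpace ℝ (Fin 3) →ₗᵢ[ℝ] EuclideanSpace ℝ (Fin 3)) (s : ℤ → ℤ) (z : ℤ → ℝ), IsHaggSeq s ∧ (∀ m : ℤ, 39 / 50 * a ≤ z (m + 1) - z m ∧ z (m + 1) - z m ≤ 17 / 20 * a) ∧ let S : Set (EuclideanSpace ℝ (Fin 3)) := {p | ∃ m k l : ℤ, p = A (((k : ℝ)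 • triangularVec₁ a) + ((l : ℝ) • triangularVec₂ a) + ((haggLabel s m : ℝ) • barlowOffset a) + (z m • layerNormal 1))}; (∀ p ∈ S, ‖p‖ ≤ R → ∃ j : Fin N, dist (x j - x i) p ≤ η) ∧ (∀ j : Fin N, ‖x j - x i‖ ≤ R → ∃ p ∈ S, dist (x j - x i) p ≤ η)} : ℝ) ≤ interactionEnergy lennardJones x - (N : ℝ) * ⨅ Q : PeriodicConfiguration 3, Q.energyPerParticle lennardJones) := by
  obtain ⟨P₀, R₁, τ, hdom, hkep⟩ := h
  -- DOM ⇒ the cell sum is at most the energy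
  have hcell : ∀ (N : ℕ) (x : Fin N → EuclideanSpace ℝ (Fin 3)), Function.Injective x →
      ∑ i, ((1 / 24 : ℝ) * siteEnergy (fun r => (r⁻¹) ^ 12) x i - (1 / 12 : ℝ) * τ ((Finset.univ.filter fun j : Fin N => dist (x j) (x i) ≤ R₁).image fun j => x j - x i))
        ≤ interactionEnergy lennardJones x := by
    intro N x hx
    have h2 := hdom N x hx
    rw [interactionEnergy_lennardJones_eq_sum]
    simp only [Finset.sum_sub_distrib, ← Finset.mul_sum]
    linarith
  -- (a) the floor
  have hfloor : ∀ (N : ℕ) (x : Fin N → EuclideanSpace ℝ (Fin 3)), Function.Injective x →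
      (N : ℝ) * P₀.energyPerParticle lennardJones ≤ interactionEnergy lennardJones x := by
    intro N x hx
    obtain ⟨δ, hδ, hsep⟩ := exists_pos_sep hx
    obtain ⟨c, hc, hcb⟩ := hkep δ hδ 1 1 one_pos one_pos
    have h1 := hcb N x hx hsep
    have h3 := hcell N x hx
    exact floor_aux h1 h3 hc (Nat.cast_nonneg _)
  -- (b) `e(P₀) = e⋆`
  have heq : P₀.energyPerParticle lennardJones
      = ⨅ Q : PeriodicConfiguration 3, Q.energyPerParticle lennardJones := by
    apply le_antisymm
    · refine ge_of_tendsto crysEnergyLimit (Filter.eventually_atTop.2 ⟨1, fun N hN => ?_⟩)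
      have hNr : (0 : ℝ) < N := by exact_mod_cast hN
      rw [le_div_iff₀ hNr, mul_comm]
      haveI := nonempty_injective_config (by norm_num : 0 < 3) N
      exact le_ciInf fun y => hfloor N y.1 y.2
    · exact eStar_le P₀
  refine ⟨P₀, hfloor, heq, ⟨⟨P₀, rfl⟩, ?_⟩, ?_⟩
  · rintro _ ⟨Q, rfl⟩
    rw [heq]
    exact eStar_le Q
  · intro δ hδ R η hR hη
    obtain ⟨c, hc, hcb⟩ := hkep δ hδ R η hR hη
    refine ⟨c, hc, fun N x hx hsep => ?_⟩
    have h1 := hcb N x hx hsep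
    have h3 := hcell N x hx
    rw [← heq]
    linarith

/-- **`FluxCellKepler` ⇒ item 0627 `CrysPeriodicMinAttained`**: the periodic infimum of the
Lennard-Jones energy per particle is attained. [folklore] -/
theorem fluxCellKepler_periodicMinAttained (h : FluxCellKepler) :
    ∃ P : PeriodicConfiguration 3,
      IsLeast (Set.range fun Q : PeriodicConfiguration 3 => Q.energyPerParticle lennardJones)
        (P.energyPerParticle lennardJones) := by
  obtain ⟨P₀, -, -, hl, -⟩ := fluxCellKepler_consequences h
  exact ⟨P₀, hl⟩

/-- **`FluxCellKepler` ⇒ conjunct (i) of the summit** (`HasPeriodicGroundStateEnergy`): with the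
tree's `crysEnergyLimit`, `E(N)/N → e(P₀)` for the forced minimiser `P₀`. [folklore] -/
theorem fluxCellKepler_hasPeriodicGroundStateEnergy (h : FluxCellKepler) :
    HasPeriodicGroundStateEnergy lennardJones 3 := by
  obtain ⟨P₀, -, heq, hl, -⟩ := fluxCellKepler_consequences h
  refine ⟨P₀, hl, ?_⟩
  rw [heq]
  exact crysEnergyLimit

end Summit.AtomisticToContinuum.Crystallization.Theorems.FluxCellKepler.Negative.Consequences

end
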